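import Summits.Ventures.HSemireg.WedgeHankelSiegelIdealBlockSum

/-!
# Venture HSemireg — THE SIEGEL IDEAL (10): a power of the polarisation cannot cancel across the Dolbeault blocks — THE `k + 1` POWERS `Θ^p/p!`,
# `p ≤ k`, DETECT THE SIEGEL IDEAL (`θ ∈ SI_k ⟺ θ ∧ E_p = 0`, `p ≤ k ≤ n`), and for EVERY power the kernel on `HT^k` is the sum of its block kernels

HONEST FRAMING. Part of the Lean index of the computation cell `pub-hsemireg` (seat p10 gen 11, Sunday typer «UNIFORM-IN-n»).
Finite-dimensional EXTERIOR ALGEBRA over a field ONLY; no variety, no cohomology theory, no sheaf, no Ext group, no semiregularity map; nothing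
here says that HC / HC_CM / HC_AV holds; no Literature fact is declared or used.  Custodian versions as in `WedgeHankelSiegelIdeal` (1/3); the
dictionary (`plane(a,b)` ↔ `H^b(⋀^a T)`, `E_p = w_n(δ_p)` ↔ `Θ^p/p!`) is QUOTED, never asserted.

WHY.  (4) `…Stable` proved `θ ∈ SI_k ⟺ θ ∧ w_n(q) = 0 ∀q ⟺ θ ∧ E_p = 0 ∀ p ≤ n` and flagged «a test family smaller than {E_0, …, E_n} beyond the middle» as
NOT typed.  THIS FILE (continues namespace `Summit.Ventures.HSemireg.Wedge.HankelSiegelIdeal`; imports (9)) closes it with the block structure of (5)/(7)/(9):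
* §16 `mul_mem_plane` (`plane(a,b) ∧ plane(a',b') ⊆ plane(a+a', b+b')`), **`exteriorPower_le_sup_plane`: `⋀^k = Σ_{a ≤ k} plane(a, k−a)`**, `disjoint_plane_sup'` /
  `eq_zero_of_sum_eq_zero` (a sum of elements of blocks with pairwise different `x`-counts vanishes only termwise — the monomial basis); **`block_mul_spike_eq_zero`:
  A POWER `E_p` CANNOT CANCEL ACROSS BLOCKS** (`θ_a ∧ E_p ∈ plane(a + n − p, k − a + p)`, distinct blocks for distinct `a`); hence **`mem_siegelIdeal_iff_forall_spike_le`: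
  for `k ≤ n`, `θ ∈ ⋀^k` lies in `SI_k ⟺ θ ∧ E_p = 0` for all `p ≤ k`** (block `a` is decided by `E_a` alone: its window on `(a, k−a)` starts with `q_a = 1`, so by (7)
  `ker_wedgeP_of_window_ne` the block component is isotropic).
* §17 **`rank_add_zeroRows_spike`: every power satisfies (9)'s hypothesis — `rank H_k(δ_p) + #(zero rows) = k + 1`** (`hankel1_spike_row`: row `a` of `H_k(δ_p)` is the unit
  vector at column `p − a` on the band `a ≤ p ≤ a + (n−k)` and zero off it; `rank_hankel1_spike_eq_card`: rank = #band, distinct unit vectors); hence **`ker_wedge_spike_eq_sup_blockKer`: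
  for EVERY power `E_p` and every `k ≤ n`, the kernel of `θ ↦ θ ∧ E_p` on `⋀^k` IS THE SUM OF ITS BLOCK KERNELS** — whole blocks `H^b(⋀^a T)` for the rows `a` off the band, their
  isotropic parts `plane(a,b) ∩ SI_k` on it ((9)'s block-sum theorem made unconditional for the powers of the polarisation).
In the quoted dictionary: to decide whether a `k`-form on an abelian `n`-fold is invisible to EVERY polynomial in `Θ` it suffices to contract it with `1, Θ, …, Θ^k/k!`; and the
kernel of `⌟(Θ^p/p!)` on `HT^k` is read off block by block with nothing in between.
NOT typed: minimality of the test family (for `2k ≤ n` the single class `Θ^k/k!` suffices, (3)); general finite families of classes; boxes; Ext side.  Class side only.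
-/

open Module

namespace Summit.Ventures.HSemireg.Wedge.HankelSiegelIdeal

open Summit.Ventures.HSemireg.Wedge Summit.Ventures.HSemireg.Wedge.Hankel
  Summit.Ventures.HSemireg.Wedge.HankelSiegel

variable (K : Type*) [Field K] {n : ℕ}

/-! ## §16. A power of the polarisation cannot cancel across blocks: `θ ∈ SI_k ⟺ θ ∧ E_p = 0` for the `k + 1` classes `p ≤ k` only -/

section SpikeTest

/-- planes multiply into planes: `plane(a,b) · plane(a',b') ⊆ plane(a+a', b+b')` (a product of two plane monomials is a plane monomial or zero). -/
lemma mul_mem_plane {a b a' b' : ℕ} {θ η : HT K (In n)} (hθ : θ ∈ plane K n a b) (hη : η ∈ plane K n a' b') :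
    θ * η ∈ plane K n (a + a') (b + b') := by
  rw [plane] at hθ hη
  induction hθ, hη using Submodule.span_induction₂ with
  | mem_mem x y hx hy =>
    obtain ⟨⟨⟨P, hP⟩, ⟨Q, hQ⟩⟩, rfl⟩ := hx
    obtain ⟨⟨⟨P', hP'⟩, ⟨Q', hQ'⟩⟩, rfl⟩ := hy
    rw [pmon, pmon, B_mul_B]
    by_cases hd : Disjoint (xs P ∪ ys Q) (xs P' ∪ ys Q')
    · have hPP : Disjoint P P' := by
        rw [Finset.disjoint_left]; intro c hc hc'
        exact Finset.disjoint_left.mp hd (Finset.mem_union_left _ (castAdd_mem_xs.mpr hc)) (Finset.mem_union_left _ (castAdd_mem_xs.mpr hc'))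
      have hQQ : Disjoint Q Q' := by
        rw [Finset.disjoint_left]; intro c hc hc'
        exact Finset.disjoint_left.mp hd (Finset.mem_union_right _ (natAdd_mem_ys.mpr hc)) (Finset.mem_union_right _ (natAdd_mem_ys.mpr hc'))
      refine Submodule.smul_mem _ _ (Submodule.subset_span ⟨((⟨P ∪ P', by rw [Finset.card_union_of_disjoint hPP, hP, hP']⟩,
        ⟨Q ∪ Q', by rw [Finset.card_union_of_disjoint hQQ, hQ, hQ']⟩) : PIdx n (a + a') (b + b')), ?_⟩)
      simp only [pmon, xs, ys, Finset.map_union]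
      congr 1
      ext i
      simp only [Finset.mem_union]
      tauto
    · rw [u_eq_zero K hd, zero_smul]; exact Submodule.zero_mem _
  | zero_left y _ => rw [zero_mul]; exact Submodule.zero_mem _
  | zero_right x _ => rw [mul_zero]; exact Submodule.zero_mem _
  | add_left x y z _ _ _ hx hy => rw [add_mul]; exact Submodule.add_mem _ hx hy
  | add_right x y z _ _ _ hx hy => rw [mul_add]; exact Submodule.add_mem _ hx hy
  | smul_left r x y _ _ hx => rw [smul_mul_assoc]; exact Submodule.smul_mem _ _ hx
  | smul_right r x y _ _ hx => rw [mul_smul_comm]; exact Submodule.smul_mem _ _ hx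

/-- **`⋀^k` is the sum of its blocks** `(a, k−a)`, `a ≤ k`. -/
theorem exteriorPower_le_sup_plane (k : ℕ) :
    (⋀[K]^k (In n → K) : Submodule K (HT K (In n))) ≤ (Finset.range (k + 1)).sup fun a => plane K n a (k - a) := by
  rw [exteriorPower_eq_Hom_univ, Hom, Submodule.span_le]
  rintro _ ⟨t, ⟨-, ht⟩, rfl⟩
  have hk : (Pof t).card + (Qof t).card = k := by rw [card_Pof_add_card_Qof, ht]
  have hmem : B K (In n) t ∈ plane K n (Pof t).card (k - (Pof t).card) := by
    have e : pmon K ((⟨Pof t, rfl⟩, ⟨Qof t, by omega⟩) : PIdx n (Pof t).card (k - (Pof t).card)) = B K (In n) t := by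
      rw [pmon]; exact congrArg _ (xs_union_ys t)
    rw [← e]; exact Submodule.subset_span ⟨_, rfl⟩
  exact (Finset.le_sup (f := fun a => plane K n a (k - a)) (Finset.mem_range.mpr (by omega))) hmem

/-- planes with a different `x`-count are disjoint from a sum of subspaces of planes (indexed through an `x`-count function). -/
lemma disjoint_plane_sup' {x b : ℕ} {F : Finset ℕ} (xc g : ℕ → ℕ) (f : ℕ → Submodule K (HT K (In n)))
    (hf : ∀ a ∈ F, f a ≤ plane K n (xc a) (g a)) (hx : ∀ a ∈ F, xc a ≠ x) : Disjoint (plane K n x b) (F.sup f) := by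
  have h1 := plane_le_span_Pof K (n := n) x b
  have h2 : F.sup f ≤ Submodule.span K ((fun t => B K (In n) t) '' {t | (Pof t).card ≠ x}) := by
    apply Finset.sup_le
    intro a ha
    refine (hf a ha).trans ((plane_le_span_Pof K (xc a) (g a)).trans (Submodule.span_mono (Set.image_mono ?_)))
    intro t ht
    rw [Set.mem_setOf_eq] at ht ⊢
    rw [ht]; exact hx a ha
  refine Disjoint.mono h1 h2 ((B K (In n)).linearIndependent.disjoint_span_image ?_)
  exact Set.disjoint_left.mpr fun t ht ht' => ht' ht

/-- a sum of elements of blocks with pairwise different `x`-counts vanishes only if every summand vanishes. -/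
lemma eq_zero_of_sum_eq_zero (F : Finset ℕ) (xc g : ℕ → ℕ) (hxc : Set.InjOn xc F) (f : ℕ → HT K (In n))
    (hf : ∀ a ∈ F, f a ∈ plane K n (xc a) (g a)) (h : ∑ a ∈ F, f a = 0) : ∀ a ∈ F, f a = 0 := by
  induction F using Finset.induction_on with
  | empty => intro a ha; exact absurd ha (Finset.notMem_empty a)
  | insert a₀ F ha₀ ih =>
    rw [Finset.sum_insert ha₀] at h
    have hrest : ∑ a ∈ F, f a ∈ F.sup (fun a => plane K n (xc a) (g a)) :=
      Submodule.sum_mem _ fun a ha => (Finset.le_sup (f := fun a => plane K n (xc a) (g a)) ha) (hf a (Finset.mem_insert_of_mem ha))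
    have hd := disjoint_plane_sup' K (x := xc a₀) (b := g a₀) xc g (fun a => plane K n (xc a) (g a)) (fun _ _ => le_rfl)
      (fun a ha hx => ha₀ (by rw [hxc (Finset.mem_insert_of_mem ha) (Finset.mem_insert_self _ _) hx] at ha; exact ha))
    have h0 : f a₀ = 0 := by
      have hmem : f a₀ ∈ plane K n (xc a₀) (g a₀) ⊓ F.sup (fun a => plane K n (xc a) (g a)) := by
        refine ⟨hf a₀ (Finset.mem_insert_self _ _), ?_⟩
        rw [eq_neg_of_add_eq_zero_left h]
        exact Submodule.neg_mem _ hrest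
      rw [hd.eq_bot] at hmem
      exact (Submodule.mem_bot K).mp hmem
    intro a ha
    rcases Finset.mem_insert.mp ha with rfl | ha
    · exact h0
    · rw [h0, zero_add] at h
      exact ih (hxc.mono (Finset.coe_subset.mpr (Finset.subset_insert _ _))) (fun a ha => hf a (Finset.mem_insert_of_mem ha)) h a ha

/-- **A POWER OF THE POLARISATION CANNOT CANCEL ACROSS BLOCKS: if `θ = Σ_a θ_a`, `θ_a ∈ plane(a, k−a)`, then `θ ∧ E_p = 0 ⟺ θ_a ∧ E_p = 0` for every `a`**
(`θ_a ∧ E_p ∈ plane(a + n − p, k − a + p)` — distinct blocks for distinct `a`). -/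
theorem block_mul_spike_eq_zero {k p : ℕ} (hp : p ≤ n) (θ : ℕ → HT K (In n)) (hθ : ∀ a ∈ Finset.range (k + 1), θ a ∈ plane K n a (k - a))
    (h : (∑ a ∈ Finset.range (k + 1), θ a) * w K n n (fun j => if j = p then (1 : K) else 0) = 0) :
    ∀ a ∈ Finset.range (k + 1), θ a * w K n n (fun j => if j = p then (1 : K) else 0) = 0 := by
  rw [Finset.sum_mul] at h
  exact eq_zero_of_sum_eq_zero K (Finset.range (k + 1)) (fun a => a + (n - p)) (fun a => k - a + p) (fun a _ b _ hab => by simpa using hab)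
    _ (fun a ha => mul_mem_plane K (hθ a ha) (w_spike_mem_plane K (m := n) le_rfl hp)) h

/-- **THE `k + 1` POWERS `Θ^p/p!`, `p ≤ k`, DETECT THE SIEGEL IDEAL in degree `k ≤ n`: `θ ∈ SI_k ⟺ θ ∧ E_p = 0` for all `p ≤ k`** (beyond the middle included; the test
family `{E_0, …, E_n}` of (4) cut down to `{E_0, …, E_k}`: block `a` is decided by `E_a` alone, whose window starts with `q_a = 1`). -/
theorem mem_siegelIdeal_iff_forall_spike_le {k : ℕ} (hk : k ≤ n) {θ : HT K (In n)} (hθ : θ ∈ ⋀[K]^k (In n → K)) :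
    θ ∈ siegelIdeal K n k ↔ ∀ p, p ≤ k → θ * w K n n (fun j => if j = p then (1 : K) else 0) = 0 := by
  constructor
  · intro h p _; exact mul_w_eq_zero_of_mem_siegelIdeal K h _
  · intro h
    have hθ' : θ ∈ ⨆ a ∈ Finset.range (k + 1), plane K n a (k - a) := by
      rw [← Finset.sup_eq_iSup]; exact exteriorPower_le_sup_plane K k hθ
    obtain ⟨μ, hμ⟩ := (Submodule.mem_iSup_finset_iff_exists_sum _ _).mp hθ'
    rw [← hμ]
    refine Submodule.sum_mem _ fun a ha => ?_
    have hak : a + (k - a) = k := by rw [Finset.mem_range] at ha; omega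
    -- block a is killed by E_a, whose window on block (a, k−a) starts with q_a = 1 ≠ 0
    have hz := block_mul_spike_eq_zero K (p := a) (by omega) (fun a => (μ a : HT K (In n))) (fun a _ => (μ a).2) (by rw [hμ]; exact h a (by omega)) a ha
    have hker : (⟨(μ a : HT K (In n)), (μ a).2⟩ : plane K n a (k - a)) ∈ LinearMap.ker (wedgeP K n a (k - a) fun j => if j = a then (1 : K) else 0) := by
      rw [LinearMap.mem_ker, wedgeP, LinearMap.comp_apply, Submodule.subtype_apply, LinearMap.mulRight_apply]; exact hz
    rw [ker_wedgeP_of_window_ne K (s := 0) (Nat.zero_le _) (by rw [add_zero, if_pos rfl]; exact one_ne_zero), Submodule.mem_comap,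
      Submodule.subtype_apply, hak] at hker
    exact hker

end SpikeTest


/-! ## §17. The powers `Θ^p/p!` satisfy the block-sum hypothesis: `rank H_k(δ_p) + #(zero rows) = k + 1` -/

section SpikeRows

/-- the window predicate of the spike `δ_p` on row `a`: non-zero iff `a ≤ p ≤ a + (n − k)`. -/
lemma spike_window_zero_iff {k p a : ℕ} :
    (∀ s, s ≤ n - k → (fun j => if j = p then (1 : K) else 0) (a + s) = 0) ↔ ¬ (a ≤ p ∧ p ≤ a + (n - k)) := by
  constructor
  · intro h ⟨h1, h2⟩
    have := h (p - a) (by omega)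
    simp only at this
    rw [if_pos (by omega)] at this
    exact one_ne_zero this
  · intro h s hs
    simp only
    rw [if_neg]
    intro he; apply h; omega

/-- the rows of `H_k(δ_p)` (`k ≤ n`): row `a` is the unit vector at column `p − a` when `a ≤ p ≤ a + (n − k)`, and zero otherwise. -/
lemma hankel1_spike_row {k : ℕ} (hk : k ≤ n) {p : ℕ} (a : Fin (k + 1)) :
    (hankel1 K n k (fun j => if j = p then (1 : K) else 0)).row a =
      if h : (a : ℕ) ≤ p ∧ p ≤ (a : ℕ) + (n - k) then Pi.basisFun K (Fin (n + 1 - k)) ⟨p - a, by omega⟩ else 0 := by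
  funext s
  have hs := s.2
  simp only [Matrix.row, hankel1, Matrix.of_apply]
  split_ifs with h1 h2
  · rw [Pi.basisFun_apply, Pi.single_apply, if_pos (Fin.ext (by simp; omega))]
  · exfalso; exact h2 ⟨by omega, by omega⟩
  · rw [Pi.basisFun_apply, Pi.single_apply, if_neg]
    intro he
    have := congrArg Fin.val he
    simp at this
    omega
  · rfl

/-- **`rank H_k(δ_p) = #{a ≤ k : a ≤ p ≤ a + (n − k)}`** (the non-zero rows are distinct unit vectors). -/
theorem rank_hankel1_spike_eq_card {k : ℕ} (hk : k ≤ n) {p : ℕ} :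
    (hankel1 K n k (fun j => if j = p then (1 : K) else 0)).rank =
      (Finset.univ.filter fun a : Fin (k + 1) => (a : ℕ) ≤ p ∧ p ≤ (a : ℕ) + (n - k)).card := by
  classical
  set B := Finset.univ.filter fun a : Fin (k + 1) => (a : ℕ) ≤ p ∧ p ≤ (a : ℕ) + (n - k) with hB
  set H := hankel1 K n k (fun j => if j = p then (1 : K) else 0)
  -- the column map on the band
  let col : B → Fin (n + 1 - k) := fun a => ⟨p - (a : Fin (k + 1)), by have := (Finset.mem_filter.mp a.2).2; have := (a : Fin (k + 1)).2; omega⟩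
  have hcol : Function.Injective col := by
    rintro ⟨a, ha⟩ ⟨a', ha'⟩ h
    have h' : p - (a : ℕ) = p - (a' : ℕ) := congrArg Fin.val h
    have h1 := (Finset.mem_filter.mp ha).2
    have h2 := (Finset.mem_filter.mp ha').2
    apply Subtype.ext
    apply Fin.ext
    show (a : ℕ) = a'
    omega
  have hrowB : ∀ a : B, H.row a = Pi.basisFun K (Fin (n + 1 - k)) (col a) := by
    rintro ⟨a, ha⟩
    rw [hankel1_spike_row K hk, dif_pos (Finset.mem_filter.mp ha).2]
  have hrow0 : ∀ a : Fin (k + 1), a ∉ B → H.row a = 0 := by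
    intro a ha
    rw [hankel1_spike_row K hk, dif_neg (fun h => ha (Finset.mem_filter.mpr ⟨Finset.mem_univ _, h⟩))]
  -- span of all rows = span of the band rows
  have hspan : Submodule.span K (Set.range H.row) = Submodule.span K (Set.range fun a : B => H.row a) := by
    apply le_antisymm
    · rw [Submodule.span_le]
      rintro _ ⟨a, rfl⟩
      by_cases ha : a ∈ B
      · exact Submodule.subset_span ⟨⟨a, ha⟩, rfl⟩
      · rw [hrow0 a ha]; exact Submodule.zero_mem _
    · rw [Submodule.span_le]
      rintro _ ⟨a, rfl⟩
      exact Submodule.subset_span ⟨a, rfl⟩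
  have hli : LinearIndependent K (fun a : B => H.row a) := by
    rw [show (fun a : B => H.row a) = (Pi.basisFun K (Fin (n + 1 - k))) ∘ col from funext hrowB]
    exact (Pi.basisFun K (Fin (n + 1 - k))).linearIndependent.comp col hcol
  rw [Matrix.rank_eq_finrank_span_row, hspan, finrank_span_eq_card hli, Fintype.card_coe]

open Classical in
/-- **EVERY POWER `Θ^p/p!` SATISFIES THE BLOCK-SUM HYPOTHESIS: `rank H_k(δ_p) + #(zero rows) = k + 1`** — its non-zero rows are distinct unit vectors. -/
theorem rank_add_zeroRows_spike {k : ℕ} (hk : k ≤ n) (p : ℕ) :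
    (hankel1 K n k (fun j => if j = p then (1 : K) else 0)).rank + zeroRows K n k (fun j => if j = p then (1 : K) else 0) = k + 1 := by
  rw [rank_hankel1_spike_eq_card K hk, zeroRows]
  have e : ((Finset.range (k + 1)).filter fun a => ∀ s, s ≤ n - k → (fun j => if j = p then (1 : K) else 0) (a + s) = 0) =
      (Finset.range (k + 1)).filter fun a => ¬ (a ≤ p ∧ p ≤ a + (n - k)) := by
    apply Finset.filter_congr
    intro a _
    exact spike_window_zero_iff K
  rw [e]
  -- transport the band count from `Fin (k+1)` to `range (k+1)`
  have e2 : (Finset.univ.filter fun a : Fin (k + 1) => (a : ℕ) ≤ p ∧ p ≤ (a : ℕ) + (n - k)).card =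
      ((Finset.range (k + 1)).filter fun a => a ≤ p ∧ p ≤ a + (n - k)).card := by
    have hr : Finset.range (k + 1) = (Finset.univ : Finset (Fin (k + 1))).map Fin.valEmbedding := by
      rw [Fin.map_valEmbedding_univ, Nat.Iio_eq_range]
    rw [hr, Finset.filter_map, Finset.card_map]
    rfl
  rw [e2, Finset.card_filter_add_card_filter_not, Finset.card_range]

/-- **hence for every power of the polarisation the kernel of `θ ↦ θ ∧ E_p` on `⋀^k` (`k ≤ n`) IS THE SUM OF ITS BLOCK KERNELS** — whole blocks `H^b(⋀^a T)` for
the rows `a` outside the band `p − (n − k) ≤ a ≤ p`, their isotropic parts inside it. -/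
theorem ker_wedge_spike_eq_sup_blockKer {k : ℕ} (hk : k ≤ n) (p : ℕ) :
    (LinearMap.ker (Hankel.wedge K n k (w K n n (fun j => if j = p then (1 : K) else 0)))).map (⋀[K]^k (In n → K)).subtype =
      (Finset.range (k + 1)).sup fun a => blockKer K n a (k - a) (fun j => if j = p then (1 : K) else 0) :=
  ker_wedge_eq_sup_blockKer K hk (rank_add_zeroRows_spike K hk p)

end SpikeRows


end Summit.Ventures.HSemireg.Wedge.HankelSiegelIdeal
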